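import Summits.QuantumFields.YangMills.Theorems.BalabanLadderUVSeamRecFloorsEngineOfReference
import Summits.QuantumFields.YangMills.Theorems.BalabanLadderNTSkewResponseOnePoint
import Summits.QuantumFields.YangMills.Theorems.BalabanLadderNTSkewResponseReference
import HarnessLib

/-!
# Crux `UVSeamRec` (stmt-QuantumFields-20043): CHECK-LEMMA — the registered v4-F `stub_floorsEngine` from the
# periodic reference package of crux `NT` in RESPONSE currency (both floors as first-order responses to local
# modulations of the coupling on ONE torus per coupling), at the fundamental representation of `SU(2)`

Helper file (`--supports stmt-QuantumFields-20043`) of the fleet lead prover of crux `NT` (unit `ym-spine-19353-p1`,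
g5).  g4's `ReferenceFloors.stubFloorsEngine_of_torusReferencePackage_rF` discharges the seam's registered
`stub_floorsEngine` statement from E1/E2/E3-osc + the `Q2` / `|Q3|` floors with margin on ONE torus per coupling.
The exact response identities of `Theorems/BalabanLadderNTSkewResponse*.lean` (g5; crux idea
`Cruxes/NT/Ideas/skewness-from-asymptotic-freedom.md`) convert, pointwise on that torus,

* a ONE-point RISE `Σ_y v(aβ y) (E^{(t·θv)}[dens_y] − E[dens_y]) ≥ (ε + M₂)·t` (`t ∈ (0, t₀]`) into the two-point
  floor `Q2(θv, v) ≥ ε + M₂` (`SkewResponse.q2_ge_of_onePointResponse_at`), and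
* a two-point DROP `Q2^{(t·h)}(f, g) − Q2(f, g) ≤ −(ε + M₃)·t` into `Q3(f,g,h) ≤ −(ε + M₃)`, hence `|Q3| ≥ ε + M₃`
  (`SkewResponse.q3_le_of_modulatedResponse_at`, `Reference.refPkgR3_of_signed`),

so the seam's femto discharge also accepts the RESPONSE package.  CLAUSES SERVED (owner R78 / director LINE №115):
conjunct 2 (the `Q2(θv, v) ≥ ε` floor) and conjunct 3 (the `|Q3(f, g, h)| ≥ ε` floor — the THREE-POINT CONJUNCT, this
lineage's supply) of the registered `stub_floorsEngine`; generality first (R75/R78 (4): compact `G`, any `LatticeRep r`,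
unit `a` a parameter), `(SU(2), rF, a/uRec → c₀)` specialised last:

* `twoPointConjunct_of_torusOnePointResponse` — general `(G, r, a)`: E1/E2-osc + (R2-resp) on ONE torus per coupling ⇒
  conjunct 2 with a compactly supported witness;
* `threePointConjunct_of_torusSigned` — general: E1/E2/E3-osc + the SIGNED floor `Q3 ≤ −(ε + M₃)` on ONE torus per
  coupling ⇒ conjunct 3 (compactly supported witnesses);
* `threePointConjunct_of_torusModulated` — general: E1/E2/E3-osc + the two-point DROP (R3-mod) ⇒ conjunct 3;
* `stubFloorsEngine_of_torusResponsePackage_rF` — the registered `stub_floorsEngine` statement verbatim at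
  `rF = fundamentalLatticeRep 2` from the response package (no SU(2)-specific step: the specialisation is literal).

Refs: `Cruxes/UVSeamRec/Lines/birth.lean` (`stub_floorsEngine`, v4-F); `…UVSeamRecFloorsEngineOfReference.lean` (g4);
ENGINE-TARGET-19353 v4.2 addendum (evidence on stmt-QuantumFields-19353).
-/

set_option autoImplicit false

noncomputable section

open scoped SchwartzMap
open MeasureTheory Filter Topology
open Literature.MathematicalPhysics.QuantumFieldTheory Literature.MathematicalPhysics.QuantumLattice
open Literature.Probability.LatticeModels
open Summit.QuantumFields.YangMills.Cruxes.OSLegsFromFemtoAndGap.DlrCollarTransfer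
open Summit.QuantumFields.YangMills.Cruxes.NT.Reference
open Summit.QuantumFields.YangMills.Cruxes.NT.SkewResponse

namespace Summit.QuantumFields.YangMills.Cruxes.UVSeamRec.ReferenceFloors


section General

variable (G : Type) [Group G] [TopologicalSpace G] [IsTopologicalGroup G] [CompactSpace G]
  [MeasurableSpace G] [BorelSpace G] (r : LatticeRep G)

/-- **Conjunct 2 of `stub_floorsEngine` (two-point floor, compactly supported witness) from a ONE-POINT RESPONSE floor
on ONE torus per coupling** — general `(G, r, a)`: units, `C₁, C₂ ≥ 0`, `σ, κ > 0`, `2(σ+κ) < ℓ`, E1/E2-osc, and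
(R2-resp): a positive-time `v` supported in the ball of radius `σ`, `ε > 0`, and for `β ≥ β₅` one torus `2L₀(β)+1`
(`aβ·L₀(β) ≥ σ+κ+1`) and `t₀(β) > 0` with `Σ_y v(aβ y)(E^{(t·θv)}[dens_y] − E[dens_y]) ≥ (ε + M₂(β))·t` on `(0, t₀(β)]`.
[folklore] -/
theorem twoPointConjunct_of_torusOnePointResponse (a : ℝ → ℝ) (ha₀ : ∀ β, 0 < a β) (ha : Tendsto a atTop (𝓝 0))
    {C₁ C₂ ℓ σ κ : ℝ} (hC₁ : 0 ≤ C₁) (hC₂ : 0 ≤ C₂) (hσ : 0 < σ) (hκ : 0 < κ) (hℓ : 2 * (σ + κ) < ℓ)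
    (hE1 : ∃ β₁ : ℝ, ∀ β : ℝ, β₁ ≤ β → ∀ (c : Fin 4 → ℤ) (b : ℕ), (b : ℝ) * a β ≤ ℓ →
      ∀ (η η' : LGConfig 4 G) (x : Fin 4 → ℤ), 1 ≤ depth c b x →
        |kerE G r β c b η (dens G r x) - kerE G r β c b η' (dens G r x)| ≤ C₁ / (depth c b x : ℝ) ^ 4)
    (hE2 : ∃ β₂ : ℝ, ∀ β : ℝ, β₂ ≤ β → ∀ (c : Fin 4 → ℤ) (b : ℕ), (b : ℝ) * a β ≤ ℓ →
      ∀ (η η' : LGConfig 4 G) (x y : Fin 4 → ℤ), 1 ≤ depth c b x → 1 ≤ depth c b y →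
        |kerCov G r β c b η (dens G r x) (dens G r y) - kerCov G r β c b η' (dens G r x) (dens G r y)| ≤
          C₂ / ((min (depth c b x) (depth c b y) : ℕ) : ℝ) ^ 4 / (1 + ‖siteToE (y - x)‖) ^ 4)
    (hR2r : ∃ (v : 𝓢(EuclideanSpace ℝ (Fin 4), ℝ)) (ε β₅ : ℝ) (L₀ : ℝ → ℕ),
      tsupport (v : EuclideanSpace ℝ (Fin 4) → ℝ) ⊆ {y | 0 < y 0} ∧
      tsupport (v : EuclideanSpace ℝ (Fin 4) → ℝ) ⊆ Metric.closedBall 0 σ ∧ 0 < ε ∧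
      ∀ β : ℝ, β₅ ≤ β → σ + κ + 1 ≤ a β * L₀ β ∧ ∃ t₀ : ℝ, 0 < t₀ ∧ ∀ t : ℝ, 0 < t → t ≤ t₀ →
        (ε + 2 * (C₁ * (a β / κ) ^ 4 * ∑ x ∈ box 4 (L₀ β), |thetaTest 4 v (a β • siteToE x)|) *
              (C₁ * (a β / κ) ^ 4 * ∑ y ∈ box 4 (L₀ β), |v (a β • siteToE y)|) +
            C₂ * (a β / κ) ^ 4 * ∑ x ∈ box 4 (L₀ β), ∑ y ∈ box 4 (L₀ β),
              |thetaTest 4 v (a β • siteToE x)| * |v (a β • siteToE y)| / (1 + ‖siteToE (y - x)‖) ^ 4) * t ≤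
          (∑ y ∈ box 4 (L₀ β), v (a β • siteToE y) *
              ∫ U, dens G r y (torusLift (2 * L₀ β + 1) U)
                ∂(wilsonMeasure (d := 4) (L := 2 * L₀ β + 1) r.ρ β).tilted fun U =>
                  t * ∑ x ∈ box 4 (L₀ β), thetaTest 4 v (a β • siteToE x) * dens G r x (torusLift (2 * L₀ β + 1) U)) -
            ∑ y ∈ box 4 (L₀ β), v (a β • siteToE y) * torusE G r β (L₀ β) (dens G r y)) :
    ∃ (v : 𝓢(EuclideanSpace ℝ (Fin 4), ℝ)) (ε β₅ Λ₅ : ℝ),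
      HasCompactSupport (v : EuclideanSpace ℝ (Fin 4) → ℝ) ∧
      tsupport (v : EuclideanSpace ℝ (Fin 4) → ℝ) ⊆ {y : EuclideanSpace ℝ (Fin 4) | 0 < y 0} ∧ 0 < ε ∧
      ∀ β : ℝ, β₅ ≤ β → ∀ L : ℕ, Λ₅ ≤ a β * L → ε ≤ Q2 G r β L (a β) (thetaTest 4 v) v := by
  obtain ⟨v, ε, β₅, L₀, hvpos, hvσ, hε, HR⟩ := hR2r
  have HR' : ∀ β : ℝ, β₅ ≤ β → σ + κ + 1 ≤ a β * L₀ β ∧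
      ε + 2 * (C₁ * (a β / κ) ^ 4 * ∑ x ∈ box 4 (L₀ β), |thetaTest 4 v (a β • siteToE x)|) *
            (C₁ * (a β / κ) ^ 4 * ∑ y ∈ box 4 (L₀ β), |v (a β • siteToE y)|) +
          C₂ * (a β / κ) ^ 4 * ∑ x ∈ box 4 (L₀ β), ∑ y ∈ box 4 (L₀ β),
            |thetaTest 4 v (a β • siteToE x)| * |v (a β • siteToE y)| / (1 + ‖siteToE (y - x)‖) ^ 4 ≤
        Q2 G r β (L₀ β) (a β) (thetaTest 4 v) v := by
    intro β hβ
    obtain ⟨hL₀, t₀, ht₀, hrise⟩ := HR β hβ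
    exact ⟨hL₀, q2_ge_of_onePointResponse_at G r β (L₀ β) (a β) (thetaTest 4 v) v ht₀ hrise⟩
  obtain ⟨β₆, H2⟩ := q2_floor_of_torusReference G r a ha₀ ha hC₁ hC₂ hσ hκ hℓ hE1 hE2 v ε β₅ L₀ hvσ HR'
  exact ⟨v, ε, β₆, σ + κ + 1, hasCompactSupport_of_tsupport_subset_closedBall hvσ, hvpos, hε, H2⟩

/-- **Conjunct 3 of `stub_floorsEngine` (three-point floor, compactly supported witnesses) from the SIGNED floor on ONE
torus per coupling** — general `(G, r, a)`: E1/E2/E3-osc and (R3-signed) `Q3_{β,L₀(β)}(f,g,h) ≤ −(ε + M₃(β))` (the sign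
the crux idea `skewness-from-asymptotic-freedom` tells the engine to certify, `σ = −1`). [folklore] -/
theorem threePointConjunct_of_torusSigned (a : ℝ → ℝ) (ha₀ : ∀ β, 0 < a β) (ha : Tendsto a atTop (𝓝 0))
    {C₁ C₂ C₃ ℓ σ κ : ℝ} (hC₁ : 0 ≤ C₁) (hC₂ : 0 ≤ C₂) (hC₃ : 0 ≤ C₃) (hσ : 0 < σ) (hκ : 0 < κ)
    (hℓ : 2 * (σ + κ) < ℓ)
    (hE1 : ∃ β₁ : ℝ, ∀ β : ℝ, β₁ ≤ β → ∀ (c : Fin 4 → ℤ) (b : ℕ), (b : ℝ) * a β ≤ ℓ →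
      ∀ (η η' : LGConfig 4 G) (x : Fin 4 → ℤ), 1 ≤ depth c b x →
        |kerE G r β c b η (dens G r x) - kerE G r β c b η' (dens G r x)| ≤ C₁ / (depth c b x : ℝ) ^ 4)
    (hE2 : ∃ β₂ : ℝ, ∀ β : ℝ, β₂ ≤ β → ∀ (c : Fin 4 → ℤ) (b : ℕ), (b : ℝ) * a β ≤ ℓ →
      ∀ (η η' : LGConfig 4 G) (x y : Fin 4 → ℤ), 1 ≤ depth c b x → 1 ≤ depth c b y →
        |kerCov G r β c b η (dens G r x) (dens G r y) - kerCov G r β c b η' (dens G r x) (dens G r y)| ≤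
          C₂ / ((min (depth c b x) (depth c b y) : ℕ) : ℝ) ^ 4 / (1 + ‖siteToE (y - x)‖) ^ 4)
    (hE3 : ∃ β₃ : ℝ, ∀ β : ℝ, β₃ ≤ β → ∀ (c : Fin 4 → ℤ) (b : ℕ), (b : ℝ) * a β ≤ ℓ →
      ∀ (η η' : LGConfig 4 G) (x y z : Fin 4 → ℤ), 1 ≤ depth c b x → 1 ≤ depth c b y → 1 ≤ depth c b z →
        |kerK3 G r β c b η x y z - kerK3 G r β c b η' x y z| ≤
          C₃ / ((min (min (depth c b x) (depth c b y)) (depth c b z) : ℕ) : ℝ) ^ 4 /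
            (1 + min (min ‖siteToE (y - x)‖ ‖siteToE (z - y)‖) ‖siteToE (z - x)‖) ^ 8)
    (hR3s : ∃ (f g h : 𝓢(EuclideanSpace ℝ (Fin 4), ℝ)) (ε β₅ : ℝ) (L₀ : ℝ → ℕ),
      Disjoint (tsupport (f : EuclideanSpace ℝ (Fin 4) → ℝ)) (tsupport (g : EuclideanSpace ℝ (Fin 4) → ℝ)) ∧
      Disjoint (tsupport (g : EuclideanSpace ℝ (Fin 4) → ℝ)) (tsupport (h : EuclideanSpace ℝ (Fin 4) → ℝ)) ∧
      Disjoint (tsupport (f : EuclideanSpace ℝ (Fin 4) → ℝ)) (tsupport (h : EuclideanSpace ℝ (Fin 4) → ℝ)) ∧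
      tsupport (f : EuclideanSpace ℝ (Fin 4) → ℝ) ⊆ Metric.closedBall 0 σ ∧
      tsupport (g : EuclideanSpace ℝ (Fin 4) → ℝ) ⊆ Metric.closedBall 0 σ ∧
      tsupport (h : EuclideanSpace ℝ (Fin 4) → ℝ) ⊆ Metric.closedBall 0 σ ∧ 0 < ε ∧
      ∀ β : ℝ, β₅ ≤ β → σ + κ + 1 ≤ a β * L₀ β ∧
        Q3 G r β (L₀ β) (a β) f g h ≤
          -(ε + ∑ x ∈ box 4 (L₀ β), ∑ y ∈ box 4 (L₀ β), ∑ z ∈ box 4 (L₀ β),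
            |f (a β • siteToE x)| * |g (a β • siteToE y)| * |h (a β • siteToE z)| *
              (2 * ((C₁ * (a β / κ) ^ 4) * (C₂ * (a β / κ) ^ 4 / (1 + ‖siteToE (z - y)‖) ^ 4) +
                    (C₁ * (a β / κ) ^ 4) * (C₂ * (a β / κ) ^ 4 / (1 + ‖siteToE (z - x)‖) ^ 4) +
                    (C₁ * (a β / κ) ^ 4) * (C₂ * (a β / κ) ^ 4 / (1 + ‖siteToE (y - x)‖) ^ 4) +
                    (C₁ * (a β / κ) ^ 4) * (C₁ * (a β / κ) ^ 4) * (C₁ * (a β / κ) ^ 4)) +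
                C₃ * (a β / κ) ^ 4 / (1 + min (min ‖siteToE (y - x)‖ ‖siteToE (z - y)‖) ‖siteToE (z - x)‖) ^ 8))) :
    ∃ (f g h : 𝓢(EuclideanSpace ℝ (Fin 4), ℝ)) (ε β₅ Λ₅ : ℝ),
      HasCompactSupport (f : EuclideanSpace ℝ (Fin 4) → ℝ) ∧
      HasCompactSupport (g : EuclideanSpace ℝ (Fin 4) → ℝ) ∧
      HasCompactSupport (h : EuclideanSpace ℝ (Fin 4) → ℝ) ∧
      Disjoint (tsupport (f : EuclideanSpace ℝ (Fin 4) → ℝ)) (tsupport (g : EuclideanSpace ℝ (Fin 4) → ℝ)) ∧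
      Disjoint (tsupport (g : EuclideanSpace ℝ (Fin 4) → ℝ)) (tsupport (h : EuclideanSpace ℝ (Fin 4) → ℝ)) ∧
      Disjoint (tsupport (f : EuclideanSpace ℝ (Fin 4) → ℝ)) (tsupport (h : EuclideanSpace ℝ (Fin 4) → ℝ)) ∧
      0 < ε ∧ ∀ β : ℝ, β₅ ≤ β → ∀ L : ℕ, Λ₅ ≤ a β * L → ε ≤ |Q3 G r β L (a β) f g h| := by
  obtain ⟨f, g, h, ε, β₅, L₀, hfg, hgh, hfh, hfσ, hgσ, hhσ, hε, HR⟩ := hR3s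
  have HR' : ∀ β : ℝ, β₅ ≤ β → σ + κ + 1 ≤ a β * L₀ β ∧
      ε + ∑ x ∈ box 4 (L₀ β), ∑ y ∈ box 4 (L₀ β), ∑ z ∈ box 4 (L₀ β),
          |f (a β • siteToE x)| * |g (a β • siteToE y)| * |h (a β • siteToE z)| *
            (2 * ((C₁ * (a β / κ) ^ 4) * (C₂ * (a β / κ) ^ 4 / (1 + ‖siteToE (z - y)‖) ^ 4) +
                  (C₁ * (a β / κ) ^ 4) * (C₂ * (a β / κ) ^ 4 / (1 + ‖siteToE (z - x)‖) ^ 4) +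
                  (C₁ * (a β / κ) ^ 4) * (C₂ * (a β / κ) ^ 4 / (1 + ‖siteToE (y - x)‖) ^ 4) +
                  (C₁ * (a β / κ) ^ 4) * (C₁ * (a β / κ) ^ 4) * (C₁ * (a β / κ) ^ 4)) +
              C₃ * (a β / κ) ^ 4 / (1 + min (min ‖siteToE (y - x)‖ ‖siteToE (z - y)‖) ‖siteToE (z - x)‖) ^ 8) ≤
        |Q3 G r β (L₀ β) (a β) f g h| := by
    intro β hβ
    obtain ⟨hL₀, hs⟩ := HR β hβ
    exact ⟨hL₀, refPkgR3_of_signed G r hs⟩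
  obtain ⟨β₇, H3⟩ := q3_floor_of_torusReference G r a ha₀ ha hC₁ hC₂ hC₃ hσ hκ hℓ hE1 hE2 hE3 f g h ε β₅ L₀
    hfσ hgσ hhσ HR'
  exact ⟨f, g, h, ε, β₇, σ + κ + 1, hasCompactSupport_of_tsupport_subset_closedBall hfσ,
    hasCompactSupport_of_tsupport_subset_closedBall hgσ, hasCompactSupport_of_tsupport_subset_closedBall hhσ,
    hfg, hgh, hfh, hε, H3⟩

/-- **Conjunct 3 of `stub_floorsEngine` from a TWO-POINT RESPONSE floor on ONE torus per coupling** — general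
`(G, r, a)`: E1/E2/E3-osc and (R3-mod): for `β ≥ β₅` one torus `2L₀(β)+1` and `t₀(β) > 0` with
`Q2^{(t·h)}_{β,L₀(β)}(f,g) − Q2_{β,L₀(β)}(f,g) ≤ −(ε + M₃(β))·t` on `(0, t₀(β)]`. [folklore] -/
theorem threePointConjunct_of_torusModulated (a : ℝ → ℝ) (ha₀ : ∀ β, 0 < a β) (ha : Tendsto a atTop (𝓝 0))
    {C₁ C₂ C₃ ℓ σ κ : ℝ} (hC₁ : 0 ≤ C₁) (hC₂ : 0 ≤ C₂) (hC₃ : 0 ≤ C₃) (hσ : 0 < σ) (hκ : 0 < κ)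
    (hℓ : 2 * (σ + κ) < ℓ)
    (hE1 : ∃ β₁ : ℝ, ∀ β : ℝ, β₁ ≤ β → ∀ (c : Fin 4 → ℤ) (b : ℕ), (b : ℝ) * a β ≤ ℓ →
      ∀ (η η' : LGConfig 4 G) (x : Fin 4 → ℤ), 1 ≤ depth c b x →
        |kerE G r β c b η (dens G r x) - kerE G r β c b η' (dens G r x)| ≤ C₁ / (depth c b x : ℝ) ^ 4)
    (hE2 : ∃ β₂ : ℝ, ∀ β : ℝ, β₂ ≤ β → ∀ (c : Fin 4 → ℤ) (b : ℕ), (b : ℝ) * a β ≤ ℓ →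
      ∀ (η η' : LGConfig 4 G) (x y : Fin 4 → ℤ), 1 ≤ depth c b x → 1 ≤ depth c b y →
        |kerCov G r β c b η (dens G r x) (dens G r y) - kerCov G r β c b η' (dens G r x) (dens G r y)| ≤
          C₂ / ((min (depth c b x) (depth c b y) : ℕ) : ℝ) ^ 4 / (1 + ‖siteToE (y - x)‖) ^ 4)
    (hE3 : ∃ β₃ : ℝ, ∀ β : ℝ, β₃ ≤ β → ∀ (c : Fin 4 → ℤ) (b : ℕ), (b : ℝ) * a β ≤ ℓ →
      ∀ (η η' : LGConfig 4 G) (x y z : Fin 4 → ℤ), 1 ≤ depth c b x → 1 ≤ depth c b y → 1 ≤ depth c b z →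
        |kerK3 G r β c b η x y z - kerK3 G r β c b η' x y z| ≤
          C₃ / ((min (min (depth c b x) (depth c b y)) (depth c b z) : ℕ) : ℝ) ^ 4 /
            (1 + min (min ‖siteToE (y - x)‖ ‖siteToE (z - y)‖) ‖siteToE (z - x)‖) ^ 8)
    (hR3m : ∃ (f g h : 𝓢(EuclideanSpace ℝ (Fin 4), ℝ)) (ε β₅ : ℝ) (L₀ : ℝ → ℕ),
      Disjoint (tsupport (f : EuclideanSpace ℝ (Fin 4) → ℝ)) (tsupport (g : EuclideanSpace ℝ (Fin 4) → ℝ)) ∧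
      Disjoint (tsupport (g : EuclideanSpace ℝ (Fin 4) → ℝ)) (tsupport (h : EuclideanSpace ℝ (Fin 4) → ℝ)) ∧
      Disjoint (tsupport (f : EuclideanSpace ℝ (Fin 4) → ℝ)) (tsupport (h : EuclideanSpace ℝ (Fin 4) → ℝ)) ∧
      tsupport (f : EuclideanSpace ℝ (Fin 4) → ℝ) ⊆ Metric.closedBall 0 σ ∧
      tsupport (g : EuclideanSpace ℝ (Fin 4) → ℝ) ⊆ Metric.closedBall 0 σ ∧
      tsupport (h : EuclideanSpace ℝ (Fin 4) → ℝ) ⊆ Metric.closedBall 0 σ ∧ 0 < ε ∧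
      ∀ β : ℝ, β₅ ≤ β → σ + κ + 1 ≤ a β * L₀ β ∧ ∃ t₀ : ℝ, 0 < t₀ ∧ ∀ t : ℝ, 0 < t → t ≤ t₀ →
        (∑ x ∈ box 4 (L₀ β), ∑ y ∈ box 4 (L₀ β), f (a β • siteToE x) * g (a β • siteToE y) *
            ((∫ U, dens G r x (torusLift (2 * L₀ β + 1) U) * dens G r y (torusLift (2 * L₀ β + 1) U)
                ∂(wilsonMeasure (d := 4) (L := 2 * L₀ β + 1) r.ρ β).tilted fun U =>
                  t * ∑ z ∈ box 4 (L₀ β), h (a β • siteToE z) * dens G r z (torusLift (2 * L₀ β + 1) U)) -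
              (∫ U, dens G r x (torusLift (2 * L₀ β + 1) U)
                ∂(wilsonMeasure (d := 4) (L := 2 * L₀ β + 1) r.ρ β).tilted fun U =>
                  t * ∑ z ∈ box 4 (L₀ β), h (a β • siteToE z) * dens G r z (torusLift (2 * L₀ β + 1) U)) *
              (∫ U, dens G r y (torusLift (2 * L₀ β + 1) U)
                ∂(wilsonMeasure (d := 4) (L := 2 * L₀ β + 1) r.ρ β).tilted fun U =>
                  t * ∑ z ∈ box 4 (L₀ β), h (a β • siteToE z) * dens G r z (torusLift (2 * L₀ β + 1) U)))) -
          Q2 G r β (L₀ β) (a β) f g ≤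
        -(ε + ∑ x ∈ box 4 (L₀ β), ∑ y ∈ box 4 (L₀ β), ∑ z ∈ box 4 (L₀ β),
            |f (a β • siteToE x)| * |g (a β • siteToE y)| * |h (a β • siteToE z)| *
              (2 * ((C₁ * (a β / κ) ^ 4) * (C₂ * (a β / κ) ^ 4 / (1 + ‖siteToE (z - y)‖) ^ 4) +
                    (C₁ * (a β / κ) ^ 4) * (C₂ * (a β / κ) ^ 4 / (1 + ‖siteToE (z - x)‖) ^ 4) +
                    (C₁ * (a β / κ) ^ 4) * (C₂ * (a β / κ) ^ 4 / (1 + ‖siteToE (y - x)‖) ^ 4) +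
                    (C₁ * (a β / κ) ^ 4) * (C₁ * (a β / κ) ^ 4) * (C₁ * (a β / κ) ^ 4)) +
                C₃ * (a β / κ) ^ 4 /
                  (1 + min (min ‖siteToE (y - x)‖ ‖siteToE (z - y)‖) ‖siteToE (z - x)‖) ^ 8)) * t) :
    ∃ (f g h : 𝓢(EuclideanSpace ℝ (Fin 4), ℝ)) (ε β₅ Λ₅ : ℝ),
      HasCompactSupport (f : EuclideanSpace ℝ (Fin 4) → ℝ) ∧
      HasCompactSupport (g : EuclideanSpace ℝ (Fin 4) → ℝ) ∧
      HasCompactSupport (h : EuclideanSpace ℝ (Fin 4) → ℝ) ∧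
      Disjoint (tsupport (f : EuclideanSpace ℝ (Fin 4) → ℝ)) (tsupport (g : EuclideanSpace ℝ (Fin 4) → ℝ)) ∧
      Disjoint (tsupport (g : EuclideanSpace ℝ (Fin 4) → ℝ)) (tsupport (h : EuclideanSpace ℝ (Fin 4) → ℝ)) ∧
      Disjoint (tsupport (f : EuclideanSpace ℝ (Fin 4) → ℝ)) (tsupport (h : EuclideanSpace ℝ (Fin 4) → ℝ)) ∧
      0 < ε ∧ ∀ β : ℝ, β₅ ≤ β → ∀ L : ℕ, Λ₅ ≤ a β * L → ε ≤ |Q3 G r β L (a β) f g h| := by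
  obtain ⟨f, g, h, ε, β₅, L₀, hfg, hgh, hfh, hfσ, hgσ, hhσ, hε, HR⟩ := hR3m
  refine threePointConjunct_of_torusSigned G r a ha₀ ha hC₁ hC₂ hC₃ hσ hκ hℓ hE1 hE2 hE3
    ⟨f, g, h, ε, β₅, L₀, hfg, hgh, hfh, hfσ, hgσ, hhσ, hε, fun β hβ => ?_⟩
  obtain ⟨hL₀, t₀, ht₀, hdrop⟩ := HR β hβ
  exact ⟨hL₀, q3_le_of_modulatedResponse_at G r β (L₀ β) (a β) h f g ht₀ hdrop⟩

end General

/-- **CHECK-LEMMA: the REGISTERED v4-F `stub_floorsEngine` statement from the periodic reference package in RESPONSE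
currency at `rF`** — `SU(2)`, Borel σ-algebra: a unit `a > 0` with `a/uRec → c₀ > 0`; `C₁, C₂, C₃ ≥ 0`, `σ, κ > 0`,
`2(σ+κ) < ℓ`; E1/E2/E3-osc on femto cubes; and on ONE torus `2L₀(β)+1` per coupling (`aβ · L₀(β) ≥ σ + κ + 1`), for
some `t₀(β) > 0` and all `t ∈ (0, t₀(β)]`, the one-point RISE (R2-resp) and the two-point DROP (R3-mod) with the
package's transfer margins ⇒ the registered `stub_floorsEngine` conclusion verbatim. [folklore] -/
theorem stubFloorsEngine_of_torusResponsePackage_rF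
    (h : letI : MeasurableSpace (Matrix.specialUnitaryGroup (Fin 2) ℂ) := borel _
      haveI : BorelSpace (Matrix.specialUnitaryGroup (Fin 2) ℂ) := ⟨rfl⟩
      ∃ (a : ℝ → ℝ) (c₀ : ℝ), 0 < c₀ ∧ (∀ β, 0 < a β) ∧
        Tendsto (fun β => a β / Transport.uRec β) atTop (𝓝 c₀) ∧
      ∃ (C₁ C₂ C₃ ℓ σ κ : ℝ), 0 ≤ C₁ ∧ 0 ≤ C₂ ∧ 0 ≤ C₃ ∧ 0 < σ ∧ 0 < κ ∧ 2 * (σ + κ) < ℓ ∧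
      (∃ β₁ : ℝ, ∀ β : ℝ, β₁ ≤ β → ∀ (c : Fin 4 → ℤ) (b : ℕ), (b : ℝ) * a β ≤ ℓ →
        ∀ (η η' : LGConfig 4 (Matrix.specialUnitaryGroup (Fin 2) ℂ)) (x : Fin 4 → ℤ), 1 ≤ depth c b x →
          |kerE (Matrix.specialUnitaryGroup (Fin 2) ℂ) (fundamentalLatticeRep 2) β c b η
              (dens (Matrix.specialUnitaryGroup (Fin 2) ℂ) (fundamentalLatticeRep 2) x) -
            kerE (Matrix.specialUnitaryGroup (Fin 2) ℂ) (fundamentalLatticeRep 2) β c b η'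
              (dens (Matrix.specialUnitaryGroup (Fin 2) ℂ) (fundamentalLatticeRep 2) x)| ≤ C₁ / (depth c b x : ℝ) ^ 4) ∧
      (∃ β₂ : ℝ, ∀ β : ℝ, β₂ ≤ β → ∀ (c : Fin 4 → ℤ) (b : ℕ), (b : ℝ) * a β ≤ ℓ →
        ∀ (η η' : LGConfig 4 (Matrix.specialUnitaryGroup (Fin 2) ℂ)) (x y : Fin 4 → ℤ), 1 ≤ depth c b x → 1 ≤ depth c b y →
          |kerCov (Matrix.specialUnitaryGroup (Fin 2) ℂ) (fundamentalLatticeRep 2) β c b η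
              (dens (Matrix.specialUnitaryGroup (Fin 2) ℂ) (fundamentalLatticeRep 2) x)
              (dens (Matrix.specialUnitaryGroup (Fin 2) ℂ) (fundamentalLatticeRep 2) y) -
            kerCov (Matrix.specialUnitaryGroup (Fin 2) ℂ) (fundamentalLatticeRep 2) β c b η'
              (dens (Matrix.specialUnitaryGroup (Fin 2) ℂ) (fundamentalLatticeRep 2) x)
              (dens (Matrix.specialUnitaryGroup (Fin 2) ℂ) (fundamentalLatticeRep 2) y)| ≤
            C₂ / ((min (depth c b x) (depth c b y) : ℕ) : ℝ) ^ 4 / (1 + ‖siteToE (y - x)‖) ^ 4) ∧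
      (∃ β₃ : ℝ, ∀ β : ℝ, β₃ ≤ β → ∀ (c : Fin 4 → ℤ) (b : ℕ), (b : ℝ) * a β ≤ ℓ →
        ∀ (η η' : LGConfig 4 (Matrix.specialUnitaryGroup (Fin 2) ℂ)) (x y z : Fin 4 → ℤ),
          1 ≤ depth c b x → 1 ≤ depth c b y → 1 ≤ depth c b z →
          |kerK3 (Matrix.specialUnitaryGroup (Fin 2) ℂ) (fundamentalLatticeRep 2) β c b η x y z -
            kerK3 (Matrix.specialUnitaryGroup (Fin 2) ℂ) (fundamentalLatticeRep 2) β c b η' x y z| ≤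
            C₃ / ((min (min (depth c b x) (depth c b y)) (depth c b z) : ℕ) : ℝ) ^ 4 /
              (1 + min (min ‖siteToE (y - x)‖ ‖siteToE (z - y)‖) ‖siteToE (z - x)‖) ^ 8) ∧
      (∃ (v : 𝓢(EuclideanSpace ℝ (Fin 4), ℝ)) (ε β₅ : ℝ) (L₀ : ℝ → ℕ),
        tsupport (v : EuclideanSpace ℝ (Fin 4) → ℝ) ⊆ {y | 0 < y 0} ∧
        tsupport (v : EuclideanSpace ℝ (Fin 4) → ℝ) ⊆ Metric.closedBall 0 σ ∧ 0 < ε ∧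
        ∀ β : ℝ, β₅ ≤ β → σ + κ + 1 ≤ a β * L₀ β ∧ ∃ t₀ : ℝ, 0 < t₀ ∧ ∀ t : ℝ, 0 < t → t ≤ t₀ →
          (ε + 2 * (C₁ * (a β / κ) ^ 4 * ∑ x ∈ box 4 (L₀ β), |thetaTest 4 v (a β • siteToE x)|) *
                (C₁ * (a β / κ) ^ 4 * ∑ y ∈ box 4 (L₀ β), |v (a β • siteToE y)|) +
              C₂ * (a β / κ) ^ 4 * ∑ x ∈ box 4 (L₀ β), ∑ y ∈ box 4 (L₀ β),
                |thetaTest 4 v (a β • siteToE x)| * |v (a β • siteToE y)| / (1 + ‖siteToE (y - x)‖) ^ 4) * t ≤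
            (∑ y ∈ box 4 (L₀ β), v (a β • siteToE y) *
                ∫ U, dens (Matrix.specialUnitaryGroup (Fin 2) ℂ) (fundamentalLatticeRep 2) y
                    (torusLift (2 * L₀ β + 1) U)
                  ∂(wilsonMeasure (d := 4) (L := 2 * L₀ β + 1) (fundamentalLatticeRep 2).ρ β).tilted fun U =>
                    t * ∑ x ∈ box 4 (L₀ β), thetaTest 4 v (a β • siteToE x) *
                      dens (Matrix.specialUnitaryGroup (Fin 2) ℂ) (fundamentalLatticeRep 2) x
                        (torusLift (2 * L₀ β + 1) U)) -
              ∑ y ∈ box 4 (L₀ β), v (a β • siteToE y) *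
                torusE (Matrix.specialUnitaryGroup (Fin 2) ℂ) (fundamentalLatticeRep 2) β (L₀ β)
                  (dens (Matrix.specialUnitaryGroup (Fin 2) ℂ) (fundamentalLatticeRep 2) y)) ∧
      (∃ (f g h : 𝓢(EuclideanSpace ℝ (Fin 4), ℝ)) (ε β₅ : ℝ) (L₀ : ℝ → ℕ),
        Disjoint (tsupport (f : EuclideanSpace ℝ (Fin 4) → ℝ)) (tsupport (g : EuclideanSpace ℝ (Fin 4) → ℝ)) ∧
        Disjoint (tsupport (g : EuclideanSpace ℝ (Fin 4) → ℝ)) (tsupport (h : EuclideanSpace ℝ (Fin 4) → ℝ)) ∧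
        Disjoint (tsupport (f : EuclideanSpace ℝ (Fin 4) → ℝ)) (tsupport (h : EuclideanSpace ℝ (Fin 4) → ℝ)) ∧
        tsupport (f : EuclideanSpace ℝ (Fin 4) → ℝ) ⊆ Metric.closedBall 0 σ ∧
        tsupport (g : EuclideanSpace ℝ (Fin 4) → ℝ) ⊆ Metric.closedBall 0 σ ∧
        tsupport (h : EuclideanSpace ℝ (Fin 4) → ℝ) ⊆ Metric.closedBall 0 σ ∧ 0 < ε ∧
        ∀ β : ℝ, β₅ ≤ β → σ + κ + 1 ≤ a β * L₀ β ∧ ∃ t₀ : ℝ, 0 < t₀ ∧ ∀ t : ℝ, 0 < t → t ≤ t₀ →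
          (∑ x ∈ box 4 (L₀ β), ∑ y ∈ box 4 (L₀ β), f (a β • siteToE x) * g (a β • siteToE y) *
              ((∫ U, dens (Matrix.specialUnitaryGroup (Fin 2) ℂ) (fundamentalLatticeRep 2) x
                    (torusLift (2 * L₀ β + 1) U) *
                  dens (Matrix.specialUnitaryGroup (Fin 2) ℂ) (fundamentalLatticeRep 2) y (torusLift (2 * L₀ β + 1) U)
                  ∂(wilsonMeasure (d := 4) (L := 2 * L₀ β + 1) (fundamentalLatticeRep 2).ρ β).tilted fun U =>
                    t * ∑ z ∈ box 4 (L₀ β), h (a β • siteToE z) *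
                      dens (Matrix.specialUnitaryGroup (Fin 2) ℂ) (fundamentalLatticeRep 2) z
                        (torusLift (2 * L₀ β + 1) U)) -
                (∫ U, dens (Matrix.specialUnitaryGroup (Fin 2) ℂ) (fundamentalLatticeRep 2) x
                    (torusLift (2 * L₀ β + 1) U)
                  ∂(wilsonMeasure (d := 4) (L := 2 * L₀ β + 1) (fundamentalLatticeRep 2).ρ β).tilted fun U =>
                    t * ∑ z ∈ box 4 (L₀ β), h (a β • siteToE z) *
                      dens (Matrix.specialUnitaryGroup (Fin 2) ℂ) (fundamentalLatticeRep 2) z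
                        (torusLift (2 * L₀ β + 1) U)) *
                (∫ U, dens (Matrix.specialUnitaryGroup (Fin 2) ℂ) (fundamentalLatticeRep 2) y
                    (torusLift (2 * L₀ β + 1) U)
                  ∂(wilsonMeasure (d := 4) (L := 2 * L₀ β + 1) (fundamentalLatticeRep 2).ρ β).tilted fun U =>
                    t * ∑ z ∈ box 4 (L₀ β), h (a β • siteToE z) *
                      dens (Matrix.specialUnitaryGroup (Fin 2) ℂ) (fundamentalLatticeRep 2) z
                        (torusLift (2 * L₀ β + 1) U)))) -
            Q2 (Matrix.specialUnitaryGroup (Fin 2) ℂ) (fundamentalLatticeRep 2) β (L₀ β) (a β) f g ≤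
          -(ε + ∑ x ∈ box 4 (L₀ β), ∑ y ∈ box 4 (L₀ β), ∑ z ∈ box 4 (L₀ β),
              |f (a β • siteToE x)| * |g (a β • siteToE y)| * |h (a β • siteToE z)| *
                (2 * ((C₁ * (a β / κ) ^ 4) * (C₂ * (a β / κ) ^ 4 / (1 + ‖siteToE (z - y)‖) ^ 4) +
                      (C₁ * (a β / κ) ^ 4) * (C₂ * (a β / κ) ^ 4 / (1 + ‖siteToE (z - x)‖) ^ 4) +
                      (C₁ * (a β / κ) ^ 4) * (C₂ * (a β / κ) ^ 4 / (1 + ‖siteToE (y - x)‖) ^ 4) +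
                      (C₁ * (a β / κ) ^ 4) * (C₁ * (a β / κ) ^ 4) * (C₁ * (a β / κ) ^ 4)) +
                  C₃ * (a β / κ) ^ 4 /
                    (1 + min (min ‖siteToE (y - x)‖ ‖siteToE (z - y)‖) ‖siteToE (z - x)‖) ^ 8)) * t)) :
    letI : MeasurableSpace (Matrix.specialUnitaryGroup (Fin 2) ℂ) := borel _
    haveI : BorelSpace (Matrix.specialUnitaryGroup (Fin 2) ℂ) := ⟨rfl⟩
    ∃ (a : ℝ → ℝ) (c₀ : ℝ), 0 < c₀ ∧ (∀ β, 0 < a β) ∧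
      Tendsto (fun β => a β / Transport.uRec β) atTop (𝓝 c₀) ∧
      (∃ (v : 𝓢(EuclideanSpace ℝ (Fin 4), ℝ)) (ε β₅ Λ₅ : ℝ),
        HasCompactSupport (v : EuclideanSpace ℝ (Fin 4) → ℝ) ∧
        tsupport (v : EuclideanSpace ℝ (Fin 4) → ℝ) ⊆ {y : EuclideanSpace ℝ (Fin 4) | 0 < y 0} ∧ 0 < ε ∧
        ∀ β : ℝ, β₅ ≤ β → ∀ L : ℕ, Λ₅ ≤ a β * L →
          ε ≤ Q2 (Matrix.specialUnitaryGroup (Fin 2) ℂ) (fundamentalLatticeRep 2) β L (a β) (thetaTest 4 v) v) ∧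
      (∃ (f g h : 𝓢(EuclideanSpace ℝ (Fin 4), ℝ)) (ε β₅ Λ₅ : ℝ),
        HasCompactSupport (f : EuclideanSpace ℝ (Fin 4) → ℝ) ∧
        HasCompactSupport (g : EuclideanSpace ℝ (Fin 4) → ℝ) ∧
        HasCompactSupport (h : EuclideanSpace ℝ (Fin 4) → ℝ) ∧
        Disjoint (tsupport (f : EuclideanSpace ℝ (Fin 4) → ℝ)) (tsupport (g : EuclideanSpace ℝ (Fin 4) → ℝ)) ∧
        Disjoint (tsupport (g : EuclideanSpace ℝ (Fin 4) → ℝ)) (tsupport (h : EuclideanSpace ℝ (Fin 4) → ℝ)) ∧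
        Disjoint (tsupport (f : EuclideanSpace ℝ (Fin 4) → ℝ)) (tsupport (h : EuclideanSpace ℝ (Fin 4) → ℝ)) ∧
        0 < ε ∧ ∀ β : ℝ, β₅ ≤ β → ∀ L : ℕ, Λ₅ ≤ a β * L →
          ε ≤ |Q3 (Matrix.specialUnitaryGroup (Fin 2) ℂ) (fundamentalLatticeRep 2) β L (a β) f g h|) := by
  letI : MeasurableSpace (Matrix.specialUnitaryGroup (Fin 2) ℂ) := borel _
  haveI : BorelSpace (Matrix.specialUnitaryGroup (Fin 2) ℂ) := ⟨rfl⟩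
  obtain ⟨a, c₀, hc₀, ha₀, hau, C₁, C₂, C₃, ℓ, σ, κ, hC₁, hC₂, hC₃, hσ, hκ, hℓ, hE1, hE2, hE3,
    ⟨v, ε, β₅, L₀, hvpos, hvσ, hε, HR⟩, ⟨f, g, h', ε', β₅', L₀', hfg, hgh, hfh, hfσ, hgσ, hhσ, hε', HR'⟩⟩ := h
  refine stubFloorsEngine_of_torusReferencePackage_rF ⟨a, c₀, hc₀, ha₀, hau, C₁, C₂, C₃, ℓ, σ, κ, hC₁, hC₂, hC₃,
    hσ, hκ, hℓ, hE1, hE2, hE3, ⟨v, ε, β₅, L₀, hvpos, hvσ, hε, fun β hβ => ?_⟩,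
    ⟨f, g, h', ε', β₅', L₀', hfg, hgh, hfh, hfσ, hgσ, hhσ, hε', fun β hβ => ?_⟩⟩
  · obtain ⟨hL₀, t₀, ht₀, hrise⟩ := HR β hβ
    exact ⟨hL₀, q2_ge_of_onePointResponse_at (Matrix.specialUnitaryGroup (Fin 2) ℂ) (fundamentalLatticeRep 2) β
      (L₀ β) (a β) (thetaTest 4 v) v ht₀ hrise⟩
  · obtain ⟨hL₀, t₀, ht₀, hdrop⟩ := HR' β hβ
    exact ⟨hL₀, refPkgR3_of_signed (Matrix.specialUnitaryGroup (Fin 2) ℂ) (fundamentalLatticeRep 2)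
      (q3_le_of_modulatedResponse_at (Matrix.specialUnitaryGroup (Fin 2) ℂ) (fundamentalLatticeRep 2) β (L₀' β)
        (a β) h' f g ht₀ hdrop)⟩

end Summit.QuantumFields.YangMills.Cruxes.UVSeamRec.ReferenceFloors

end
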